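import Mathlib.RingTheory.DiscreteValuationRing.Basic
import Mathlib.RingTheory.Valuation.Basic
import Mathlib.RingTheory.Localization.FractionRing
import Mathlib.RingTheory.IntegralClosure.IsIntegral.Basic
import Mathlib.RingTheory.Finiteness.Cardinality
import Mathlib.Algebra.Field.ZMod
import Mathlib.Data.Nat.Choose.Dvd
import Mathlib.Data.Fintype.Pigeonhole
import HarnessLib

/-!
# Valuation lemmas for "infinitely divisible units are torsion" over a DVR

Four elementary lemmas used in `DVRDivisibleUnitsTorsion.lean` (the field-theoretic input of the
class-field-theory-free proof of [Tpcs] Lemma 4.14, S. Mochizuki, *Topics surrounding the anabelian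
geometry of hyperbolic curves* (2003), p. 48; cell decl `Tpcs.Lem_4_14`):

* `withZero_eq_one_of_forall_pow`: in `ℤₘ₀`, a nonzero element with `N`-th roots for all `N` is `1`;
* `valuation_pow_prime_sub_one_le`: the Frobenius contraction `v(yᵖ - 1) ≤ v(y - 1)·max(v(p), v(y - 1))`;
* `exists_pow_eq_one_of_isIntegral_zmod`: a nonzero element of a field integral over `𝔽_p` has
  finite multiplicative order;
* `exists_eq_algebraMap_of_valuation_le_one`: for a DVR `A` with uniformizer `ϖ` and a valuation
  `v` on an extension `M` of `Frac A` with `v ≤ 1` on `A` and `v(ϖ) < 1`, elements of `Frac A` of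
  valuation `≤ 1` come from `A`.

Proof-only, no definitions, Mathlib only. [cite: MochizukiTopics2003, Lem 4.14 p.48]
-/

noncomputable section

open scoped Classical

namespace Literature.AnabelianGeometry.AbsoluteAnabelian

universe u v w

/-- In `ℤₘ₀ = WithZero (Multiplicative ℤ)`, a nonzero element admitting `N`-th roots for every
`N ≥ 1` equals `1`. [cite: MochizukiTopics2003, Lem 4.14 p.48] -/
theorem withZero_eq_one_of_forall_pow {γ : WithZero (Multiplicative ℤ)} (hγ : γ ≠ 0)
    (h : ∀ N : ℕ, 0 < N → ∃ δ : WithZero (Multiplicative ℤ), δ ^ N = γ) : γ = 1 := by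
  obtain ⟨g, rfl⟩ := WithZero.ne_zero_iff_exists.mp hγ
  set a : ℤ := Multiplicative.toAdd g with ha
  obtain ⟨δ, hδ⟩ := h (a.natAbs + 1) (Nat.succ_pos _)
  have hδ0 : δ ≠ 0 := by
    rintro rfl
    rw [zero_pow (Nat.succ_ne_zero _)] at hδ
    exact WithZero.coe_ne_zero hδ.symm
  obtain ⟨d, rfl⟩ := WithZero.ne_zero_iff_exists.mp hδ0
  rw [← WithZero.coe_pow, WithZero.coe_inj] at hδ
  have hint : ((a.natAbs + 1 : ℕ) : ℤ) * Multiplicative.toAdd d = a := by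
    have := congrArg Multiplicative.toAdd hδ
    rwa [toAdd_pow, nsmul_eq_mul] at this
  have hnat : (a.natAbs + 1) * (Multiplicative.toAdd d).natAbs = a.natAbs := by
    have := congrArg Int.natAbs hint
    rwa [Int.natAbs_mul, Int.natAbs_natCast] at this
  have hb : (Multiplicative.toAdd d).natAbs = 0 := by
    rcases Nat.eq_zero_or_pos (Multiplicative.toAdd d).natAbs with h0 | hpos
    · exact h0
    · have := Nat.le_mul_of_pos_right (a.natAbs + 1) hpos
      omega
  have ha0 : a = 0 := by
    rw [← hint, Int.natAbs_eq_zero.mp hb, mul_zero]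
  have : g = 1 := by
    rw [ha] at ha0
    exact toAdd_eq_zero.mp ha0
  rw [this, WithZero.coe_one]

/-- A power of a nonzero element of `ℤₘ₀` is `1` only if the element is `1` (or the exponent is
`0`). [cite: MochizukiTopics2003, Lem 4.14 p.48] -/
theorem withZero_eq_one_of_pow_eq_one {γ : WithZero (Multiplicative ℤ)} (hγ : γ ≠ 0) {N : ℕ}
    (hN : N ≠ 0) (h : γ ^ N = 1) : γ = 1 := by
  obtain ⟨g, rfl⟩ := WithZero.ne_zero_iff_exists.mp hγ
  rw [← WithZero.coe_pow, ← WithZero.coe_one, WithZero.coe_inj] at h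
  have : Multiplicative.toAdd g = 0 := by
    have h' := congrArg Multiplicative.toAdd h
    rw [toAdd_pow, toAdd_one, nsmul_eq_mul, mul_eq_zero] at h'
    exact h'.resolve_left (by exact_mod_cast hN)
  rw [show g = 1 from toAdd_eq_zero.mp this, WithZero.coe_one]

/-- **Frobenius contraction.**  For a valuation `v` on a field `M`, a prime `p`, and `y` with
`v(y - 1) < 1`: `v(yᵖ - 1) ≤ v(y - 1) · max (v p) (v (y - 1))` (binomial expansion; `p ∣ C(p,i)`
for `0 < i < p`). [cite: MochizukiTopics2003, Lem 4.14 p.48] -/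
theorem valuation_pow_prime_sub_one_le {M : Type u} [Field M] {Γ₀ : Type v}
    [LinearOrderedCommGroupWithZero Γ₀] (v : Valuation M Γ₀) {p : ℕ} (hprime : p.Prime)
    (hnat : ∀ c : ℕ, v (c : M) ≤ 1) (y : M) (hy : v (y - 1) < 1) :
    v (y ^ p - 1) ≤ v (y - 1) * max (v (p : M)) (v (y - 1)) := by
  set b : M := y - 1 with hb
  have hyb : y = b + 1 := by rw [hb]; ring
  have hb1 : v b ≤ 1 := hy.le
  rw [hyb, add_pow]
  -- `(b+1)^p - 1 = ∑_{i ∈ range p} b^(i+1) * C(p, i+1)`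
  rw [Finset.sum_range_succ', pow_zero, one_pow, Nat.choose_zero_right, Nat.cast_one, mul_one,
    mul_one, add_sub_cancel_right]
  refine Valuation.map_sum_le _ fun i hi => ?_
  rw [Finset.mem_range] at hi
  rw [one_pow, mul_one, map_mul, map_pow]
  by_cases hip : i + 1 < p
  · -- `p ∣ C(p, i+1)`
    obtain ⟨c, hc⟩ := Nat.Prime.dvd_choose_self hprime (Nat.succ_ne_zero i) hip
    rw [hc, Nat.cast_mul, map_mul]
    calc v b ^ (i + 1) * (v (p : M) * v (c : M))
        ≤ v b ^ 1 * (v (p : M) * 1) :=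
          mul_le_mul' (pow_le_pow_right_of_le_one' hb1 (Nat.le_add_left 1 i))
            (mul_le_mul' le_rfl (hnat c))
      _ = v b * v (p : M) := by rw [pow_one, mul_one]
      _ ≤ v b * max (v (p : M)) (v b) := by gcongr; exact le_max_left _ _
  · -- `i + 1 = p`: the term `b^p`
    have hpi : i + 1 = p := by omega
    rw [hpi, Nat.choose_self, Nat.cast_one, map_one, mul_one]
    have hp2 : 2 ≤ p := hprime.two_le
    calc v b ^ p ≤ v b ^ 2 := pow_le_pow_right_of_le_one' hb1 hp2
      _ = v b * v b := pow_two _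
      _ ≤ v b * max (v (p : M)) (v b) := by gcongr; exact le_max_right _ _

/-- A nonzero element of a field which is integral over `𝔽_p` has finite multiplicative order (it
lives in the finite ring `𝔽_p[x]`). [cite: MochizukiTopics2003, Lem 4.14 p.48] -/
theorem exists_pow_eq_one_of_isIntegral_zmod {κ : Type u} [Field κ] {p : ℕ} [Fact p.Prime]
    [Algebra (ZMod p) κ] {x : κ} (hx0 : x ≠ 0) (hint : IsIntegral (ZMod p) x) :
    ∃ m : ℕ, 0 < m ∧ x ^ m = 1 := by
  set S := Algebra.adjoin (ZMod p) ({x} : Set κ) with hS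
  haveI : Module.Finite (ZMod p) S := Algebra.finite_adjoin_simple_of_isIntegral hint
  haveI : Finite S := Module.finite_of_finite (ZMod p)
  have hxS : x ∈ S := Algebra.self_mem_adjoin_singleton (ZMod p) x
  obtain ⟨i, i', hne, heq⟩ :=
    Finite.exists_ne_map_eq_of_infinite (fun k : ℕ => (⟨x ^ k, pow_mem hxS k⟩ : S))
  have heq' : x ^ i = x ^ i' := congrArg Subtype.val heq
  rcases lt_or_gt_of_ne hne with hlt | hlt
  · refine ⟨i' - i, Nat.sub_pos_of_lt hlt, ?_⟩
    obtain ⟨e, rfl⟩ := Nat.exists_eq_add_of_lt hlt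
    rw [show i + e + 1 - i = e + 1 by omega]
    rw [show i + e + 1 = i + (e + 1) by ring, pow_add] at heq'
    exact (mul_eq_left₀ (pow_ne_zero _ hx0)).mp heq'.symm
  · refine ⟨i - i', Nat.sub_pos_of_lt hlt, ?_⟩
    obtain ⟨e, rfl⟩ := Nat.exists_eq_add_of_lt hlt
    rw [show i' + e + 1 - i' = e + 1 by omega]
    rw [show i' + e + 1 = i' + (e + 1) by ring, pow_add] at heq'
    exact (mul_eq_left₀ (pow_ne_zero _ hx0)).mp heq'

/-- For a DVR `A` with uniformizer `ϖ`, `F = Frac A ⊆ M`, and a valuation `v` on `M` with `v ≤ 1` on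
`A` and `v(ϖ) < 1`: an element of `F` of valuation `≤ 1` lies in `A` (write it as `u ϖ^k`, `k ∈ ℤ`).
[cite: MochizukiTopics2003, Lem 4.14 p.48] -/
theorem exists_eq_algebraMap_of_valuation_le_one {A : Type u} [CommRing A] [IsDomain A]
    [IsDiscreteValuationRing A] {F : Type v} [Field F] [Algebra A F] [IsFractionRing A F]
    {M : Type w} [Field M] [Algebra F M] [Algebra A M] [IsScalarTower A F M]
    {Γ₀ : Type*} [LinearOrderedCommGroupWithZero Γ₀] (v : Valuation M Γ₀)
    (hvA : ∀ a : A, v (algebraMap A M a) ≤ 1) {ϖ : A} (hϖ : Irreducible ϖ)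
    (hvϖ : v (algebraMap A M ϖ) < 1) (z : F) (hz : v (algebraMap F M z) ≤ 1) :
    ∃ a : A, algebraMap A F a = z := by
  have hvunit : ∀ u : Aˣ, v (algebraMap A M (u : A)) = 1 := by
    intro u
    refine le_antisymm (hvA u) ?_
    have h1 : v (algebraMap A M (u : A)) * v (algebraMap A M (↑u⁻¹ : A)) = 1 := by
      rw [← map_mul, ← map_mul, Units.mul_inv, map_one, map_one]
    calc (1 : Γ₀) = v (algebraMap A M (u : A)) * v (algebraMap A M (↑u⁻¹ : A)) := h1.symm
      _ ≤ v (algebraMap A M (u : A)) * 1 := by gcongr; exact hvA _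
      _ = _ := mul_one _
  by_cases hz0 : z = 0
  · exact ⟨0, by rw [hz0, map_zero]⟩
  obtain ⟨a, b, hb, rfl⟩ := IsFractionRing.div_surjective (A := A) z
  have hb0 : b ≠ 0 := nonZeroDivisors.ne_zero hb
  have ha0 : a ≠ 0 := by
    rintro rfl
    exact hz0 (by rw [map_zero, zero_div])
  obtain ⟨j, ua, rfl⟩ := IsDiscreteValuationRing.eq_unit_mul_pow_irreducible ha0 hϖ
  obtain ⟨k, ub, rfl⟩ := IsDiscreteValuationRing.eq_unit_mul_pow_irreducible hb0 hϖ
  have hϖF0 : algebraMap A F ϖ ≠ 0 :=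
    (map_ne_zero_iff _ (IsFractionRing.injective A F)).mpr hϖ.ne_zero
  have hubF0 : algebraMap A F (ub : A) ≠ 0 :=
    (map_ne_zero_iff _ (IsFractionRing.injective A F)).mpr ub.ne_zero
  rcases le_or_gt k j with hkj | hjk
  · -- `z = (ua/ub) ϖ^(j-k) ∈ A`
    refine ⟨(ua : A) * (↑ub⁻¹ : A) * ϖ ^ (j - k), ?_⟩
    obtain ⟨d, rfl⟩ := Nat.exists_eq_add_of_le hkj
    rw [Nat.add_sub_cancel_left]
    simp only [map_mul, map_pow, pow_add]
    rw [eq_div_iff (mul_ne_zero hubF0 (pow_ne_zero _ hϖF0))]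
    have huu : algebraMap A F (ub : A) * algebraMap A F (↑ub⁻¹ : A) = 1 := by
      rw [← map_mul, Units.mul_inv, map_one]
    linear_combination (algebraMap A F (ua : A) * algebraMap A F ϖ ^ k * algebraMap A F ϖ ^ d) * huu
  · -- `v z > 1`: contradiction
    exfalso
    obtain ⟨d, rfl⟩ := Nat.exists_eq_add_of_lt hjk
    set z : F := algebraMap A F (↑ua * ϖ ^ j) / algebraMap A F (↑ub * ϖ ^ (j + d + 1)) with hzdef
    have hrel : algebraMap F M z * algebraMap A M (ϖ ^ (d + 1)) * algebraMap A M (ub : A) =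
        algebraMap A M (ua : A) := by
      simp only [IsScalarTower.algebraMap_apply A F M]
      rw [← map_mul, ← map_mul]
      congr 1
      simp only [hzdef, map_mul, map_pow]
      rw [div_mul_eq_mul_div, div_mul_eq_mul_div,
        div_eq_iff (mul_ne_zero hubF0 (pow_ne_zero _ hϖF0))]
      ring
    have hval := congrArg v hrel
    simp only [map_mul, map_pow, hvunit, mul_one] at hval
    have hlt : v (algebraMap F M z) * v (algebraMap A M ϖ) ^ (d + 1) < 1 := by
      calc _ ≤ 1 * v (algebraMap A M ϖ) ^ (d + 1) := by gcongr
        _ = v (algebraMap A M ϖ) ^ (d + 1) := one_mul _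
        _ < 1 := pow_lt_one₀ zero_le hvϖ (Nat.succ_ne_zero _)
    rw [hval] at hlt
    exact lt_irrefl _ hlt

end Literature.AnabelianGeometry.AbsoluteAnabelian
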